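import Summits.Ventures.Crystal3D.Theorems.StickyWulffConstantCoaxialWallLawSlotTriangle
import Summits.Ventures.Crystal3D.Theorems.StickyWulffConstantGenericWallFloorCredits
import HarnessLib

/-!
# The certified states of the word automaton form a finite set, at most `220` per ball (v2, W8)

HONEST FRAMING. Part of the venture `Summits/Ventures/Crystal3D` (cell `crystal3d-full`), helper for the
crux `CoaxialWallLaw` (stmt-Ventures-19481) of `route-Ventures-StickyWulffConstant`, REGISTERED line
`WallLedgerF` (planner cf-p1 gen 16), open stub `stub_coaxialTwoSlabAdhesion` (general fillings).  Brick W8 of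
the v2 (NET) line automaton (memo F-NET-AUTOMATON-v2 §7, evidence on the crux item): the inputs `W`, `hW`,
`hmult` of the abstract count `word_sources_le`.  Rung credit only; F-C1 not moved.

SETTING.  Classes `κ : K` (ANY type) with frames `F κ` and directions `d κ`, RIGID in the sense of
`…WordRigidity`: `F κ '' fccSlots = F κ' '' fccSlots → κ = κ'` (hypothesis `hinj`).  A state `(b, κ)` is
CERTIFIED when `b ∈ X`, a `60°` triangle `a, a', a''` of slots has `b + F κ a, b + F κ a', b + F κ a'' ∈ X`, and
`b − d κ ∈ X`.

**Theorem (`exists_certified_states`).**  For a `1`-separated `X` there is a `Finset` `W` of states with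
`v ∈ W ↔ v certified`, and every ball carries at most `220 = C(12,3)` certified states.  Proof: a certified
state at `b` is determined by the `3`-set `{b + F κ a, b + F κ a', b + F κ a''}` of neighbours of `b` (the
triangle pins the slot dozen, `image_fccSlots_eq_of_triangle`, and the dozen pins the class, `hinj`); the
neighbours at distance `1` are at most `12` (`card_filter_dist_eq_one_le_twelve`).

WHAT THIS IS NOT: not the stub; F-C1 not moved.
-/

noncomputable section

namespace Summit.Ventures.Crystal3D.Theorems

open Summit.Ventures.Crystal3D Finset
open Literature.MathematicalPhysics.StatisticalMechanics (fccStacking)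
open scoped InnerProductSpace

section States

variable {K : Type*} {X : Finset (EuclideanSpace ℝ (Fin 3))}
  {F : K → (EuclideanSpace ℝ (Fin 3) ≃ₗᵢ[ℝ] EuclideanSpace ℝ (Fin 3))} {d : K → EuclideanSpace ℝ (Fin 3)}

/-- Two adjacent slots of a frame are distinct vectors. -/
theorem frame_slot_ne_of_inner_half (G : EuclideanSpace ℝ (Fin 3) ≃ₗᵢ[ℝ] EuclideanSpace ℝ (Fin 3))
    {a a' : EuclideanSpace ℝ (Fin 3)} (ha : a ∈ fccSlots) (h : ⟪a, a'⟫_ℝ = 1 / 2) : G a ≠ G a' := by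
  intro heq
  have haa : ⟪a, a⟫_ℝ = 1 := by rw [real_inner_self_eq_norm_sq, norm_eq_one_of_mem_fccSlots ha, one_pow]
  rw [G.injective heq, ← G.injective heq] at h
  linarith

/-- **Two rigid classes sharing a triangle of neighbours at one ball coincide.**  If the `3`-sets
`{b + F κ aᵢ}` and `{b + F κ' a'ⱼ}` of two `60°` slot triangles are equal, then `κ = κ'`. -/
theorem class_eq_of_triangle_set_eq
    (hinj : ∀ κ κ' : K, (F κ : EuclideanSpace ℝ (Fin 3) → EuclideanSpace ℝ (Fin 3)) '' ↑fccSlots =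
      (F κ' : EuclideanSpace ℝ (Fin 3) → EuclideanSpace ℝ (Fin 3)) '' ↑fccSlots → κ = κ')
    {κ κ' : K} {b : EuclideanSpace ℝ (Fin 3)} {a a' a'' c c' c'' : EuclideanSpace ℝ (Fin 3)}
    (ha : a ∈ fccSlots) (ha' : a' ∈ fccSlots) (ha'' : a'' ∈ fccSlots)
    (i1 : ⟪a, a'⟫_ℝ = 1 / 2) (i2 : ⟪a, a''⟫_ℝ = 1 / 2) (i3 : ⟪a', a''⟫_ℝ = 1 / 2)
    (hc : c ∈ fccSlots) (hc' : c' ∈ fccSlots) (hc'' : c'' ∈ fccSlots)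
    (heq : ({b + F κ a, b + F κ a', b + F κ a''} : Finset (EuclideanSpace ℝ (Fin 3))) =
      {b + F κ' c, b + F κ' c', b + F κ' c''}) : κ = κ' := by
  classical
  have key : ∀ x, b + F κ x ∈ ({b + F κ' c, b + F κ' c', b + F κ' c''} : Finset (EuclideanSpace ℝ (Fin 3))) →
      F κ x ∈ (F κ' : EuclideanSpace ℝ (Fin 3) → EuclideanSpace ℝ (Fin 3)) '' ↑fccSlots := by
    intro x hx
    simp only [mem_insert, mem_singleton, add_right_inj] at hx
    rcases hx with h | h | h
    · exact ⟨c, Finset.mem_coe.2 hc, h.symm⟩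
    · exact ⟨c', Finset.mem_coe.2 hc', h.symm⟩
    · exact ⟨c'', Finset.mem_coe.2 hc'', h.symm⟩
  refine hinj κ κ' (image_fccSlots_eq_of_triangle (F κ) (F κ') ha ha' ha'' i1 i2 i3 ?_ ?_ ?_)
  · exact key a (by rw [← heq]; simp)
  · exact key a' (by rw [← heq]; simp)
  · exact key a'' (by rw [← heq]; simp)

open scoped Classical in
/-- **The certified states form a finite set, at most `220` per ball.**  See the module docstring. -/
theorem exists_certified_states (hX : ∀ p ∈ X, ∀ q ∈ X, p ≠ q → 1 ≤ dist p q)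
    (hinj : ∀ κ κ' : K, (F κ : EuclideanSpace ℝ (Fin 3) → EuclideanSpace ℝ (Fin 3)) '' ↑fccSlots =
      (F κ' : EuclideanSpace ℝ (Fin 3) → EuclideanSpace ℝ (Fin 3)) '' ↑fccSlots → κ = κ') :
    ∃ W : Finset (EuclideanSpace ℝ (Fin 3) × K),
      (∀ v, v ∈ W ↔ (v.1 ∈ X ∧
        (∃ a ∈ fccSlots, ∃ a' ∈ fccSlots, ∃ a'' ∈ fccSlots,
          ⟪a, a'⟫_ℝ = 1 / 2 ∧ ⟪a, a''⟫_ℝ = 1 / 2 ∧ ⟪a', a''⟫_ℝ = 1 / 2 ∧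
          v.1 + F v.2 a ∈ X ∧ v.1 + F v.2 a' ∈ X ∧ v.1 + F v.2 a'' ∈ X) ∧
        v.1 - d v.2 ∈ X)) ∧
      ∀ b ∈ X, (W.filter fun v => v.1 = b).card ≤ 220 := by
  -- the certified states
  set cert : EuclideanSpace ℝ (Fin 3) × K → Prop := fun v => v.1 ∈ X ∧
      (∃ a ∈ fccSlots, ∃ a' ∈ fccSlots, ∃ a'' ∈ fccSlots,
        ⟪a, a'⟫_ℝ = 1 / 2 ∧ ⟪a, a''⟫_ℝ = 1 / 2 ∧ ⟪a', a''⟫_ℝ = 1 / 2 ∧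
        v.1 + F v.2 a ∈ X ∧ v.1 + F v.2 a' ∈ X ∧ v.1 + F v.2 a'' ∈ X) ∧
      v.1 - d v.2 ∈ X with hcert
  -- the pieces: states at `b` whose triangle of neighbours is `{p, q, r}`
  set piece : EuclideanSpace ℝ (Fin 3) → Finset (EuclideanSpace ℝ (Fin 3)) →
      Set (EuclideanSpace ℝ (Fin 3) × K) := fun b t =>
    {v | v.1 = b ∧ ∃ a ∈ fccSlots, ∃ a' ∈ fccSlots, ∃ a'' ∈ fccSlots,
      ⟪a, a'⟫_ℝ = 1 / 2 ∧ ⟪a, a''⟫_ℝ = 1 / 2 ∧ ⟪a', a''⟫_ℝ = 1 / 2 ∧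
      ({b + F v.2 a, b + F v.2 a', b + F v.2 a''} : Finset (EuclideanSpace ℝ (Fin 3))) = t} with hpiece
  have hsub1 : ∀ b t, (piece b t).Subsingleton := by
    intro b t v hv v' hv'
    obtain ⟨hb, a, ha, a', ha', a'', ha'', i1, i2, i3, ht⟩ := hv
    obtain ⟨hb', c, hc, c', hc', c'', hc'', -, -, -, ht'⟩ := hv'
    have hκ : v.2 = v'.2 :=
      class_eq_of_triangle_set_eq hinj ha ha' ha'' i1 i2 i3 hc hc' hc'' (ht.trans ht'.symm)
    exact Prod.ext (hb.trans hb'.symm) hκ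
  -- the triangle of a certified state as a `3`-subset of the neighbours of its ball
  have htri : ∀ v, cert v → ∃ t ∈ (X.filter fun q => dist v.1 q = 1).powersetCard 3, v ∈ piece v.1 t := by
    intro v hv
    obtain ⟨hvX, ⟨a, ha, a', ha', a'', ha'', i1, i2, i3, h1, h2, h3⟩, -⟩ := hv
    refine ⟨{v.1 + F v.2 a, v.1 + F v.2 a', v.1 + F v.2 a''}, ?_, rfl, a, ha, a', ha', a'', ha'', i1, i2, i3, rfl⟩
    rw [mem_powersetCard]
    have hd : ∀ x ∈ fccSlots, dist v.1 (v.1 + F v.2 x) = 1 := by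
      intro x hx
      rw [dist_eq_norm, sub_add_cancel_left, norm_neg, LinearIsometryEquiv.norm_map, norm_eq_one_of_mem_fccSlots hx]
    constructor
    · intro x hx
      simp only [mem_insert, mem_singleton] at hx
      rw [mem_filter]
      rcases hx with rfl | rfl | rfl
      · exact ⟨h1, hd a ha⟩
      · exact ⟨h2, hd a' ha'⟩
      · exact ⟨h3, hd a'' ha''⟩
    · have n12 : v.1 + F v.2 a ≠ v.1 + F v.2 a' := by
        rw [Ne, add_right_inj]; exact frame_slot_ne_of_inner_half (F v.2) ha i1
      have n13 : v.1 + F v.2 a ≠ v.1 + F v.2 a'' := by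
        rw [Ne, add_right_inj]; exact frame_slot_ne_of_inner_half (F v.2) ha i2
      have n23 : v.1 + F v.2 a' ≠ v.1 + F v.2 a'' := by
        rw [Ne, add_right_inj]; exact frame_slot_ne_of_inner_half (F v.2) ha' i3
      rw [card_insert_of_notMem, card_insert_of_notMem, card_singleton]
      · simpa using n23
      · simp [n12, n13]
  -- (1) finiteness: the certified states sit in finitely many subsingleton pieces
  have hfin : {v | cert v}.Finite := by
    have hbig : (⋃ b ∈ (↑X : Set (EuclideanSpace ℝ (Fin 3))),
        ⋃ t ∈ (↑((X.filter fun q => dist b q = 1).powersetCard 3) : Set (Finset (EuclideanSpace ℝ (Fin 3)))),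
          piece b t).Finite := by
      refine Set.Finite.biUnion X.finite_toSet fun b _ => ?_
      refine Set.Finite.biUnion (Finset.finite_toSet _) fun t _ => (hsub1 b t).finite
    refine hbig.subset fun v hv => ?_
    obtain ⟨t, ht, hvt⟩ := htri v hv
    simp only [Set.mem_iUnion]
    exact ⟨v.1, Finset.mem_coe.2 hv.1, t, Finset.mem_coe.2 ht, hvt⟩
  refine ⟨hfin.toFinset, fun v => by rw [Set.Finite.mem_toFinset]; rfl, ?_⟩
  -- (2) multiplicity
  intro b hb
  set N := X.filter fun q => dist b q = 1 with hN
  set T := N.powersetCard 3 with hT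
  have hTcard : T.card ≤ 220 := by
    rw [hT, card_powersetCard]
    have h12 : N.card ≤ 12 := card_filter_dist_eq_one_le_twelve X hX b
    exact (Nat.choose_le_choose 3 h12).trans (by decide)
  set Wb := hfin.toFinset.filter fun v => v.1 = b with hWb
  have hcov : Wb ⊆ T.biUnion fun t => Wb.filter fun v => v ∈ piece b t := by
    intro v hv
    obtain ⟨hvW, hvb⟩ := mem_filter.1 hv
    have hcv : cert v := by
      have := (Set.Finite.mem_toFinset hfin).1 hvW
      simpa only [Set.mem_setOf_eq] using this
    obtain ⟨t, ht, hvt⟩ := htri v hcv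
    rw [hvb] at ht hvt
    rw [mem_biUnion]
    exact ⟨t, ht, mem_filter.2 ⟨hv, hvt⟩⟩
  calc Wb.card ≤ (T.biUnion fun t => Wb.filter fun v => v ∈ piece b t).card := card_le_card hcov
    _ ≤ ∑ t ∈ T, (Wb.filter fun v => v ∈ piece b t).card := card_biUnion_le
    _ ≤ ∑ _t ∈ T, 1 := sum_le_sum fun t _ => by
        rw [Finset.card_le_one]
        intro x hx y hy
        exact hsub1 b t (mem_filter.1 hx).2 (mem_filter.1 hy).2
    _ = T.card := by rw [sum_const, smul_eq_mul, mul_one]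
    _ ≤ 220 := hTcard


/-- The three corners of a certified triangle are pairwise at distance `1`. -/
theorem dist_frame_slots_eq_one (G : EuclideanSpace ℝ (Fin 3) ≃ₗᵢ[ℝ] EuclideanSpace ℝ (Fin 3))
    (b : EuclideanSpace ℝ (Fin 3)) {a a' : EuclideanSpace ℝ (Fin 3)} (ha : a ∈ fccSlots) (ha' : a' ∈ fccSlots)
    (h : ⟪a, a'⟫_ℝ = 1 / 2) : dist (b + G a) (b + G a') = 1 := by
  have hna : ‖a‖ = 1 := norm_eq_one_of_mem_fccSlots ha
  have hna' : ‖a'‖ = 1 := norm_eq_one_of_mem_fccSlots ha'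
  rw [dist_eq_norm, add_sub_add_left_eq_sub, ← map_sub, LinearIsometryEquiv.norm_map]
  have h2 : ‖a - a'‖ ^ 2 = 1 := by rw [@norm_sub_sq_real, hna, hna', h]; norm_num
  nlinarith [norm_nonneg (a - a')]

open scoped Classical in
/-- **Sharper multiplicity: certified states at a ball are at most the number of UNIT TRIANGLES among its
neighbours.**  For any finite set `W` of states with the certification characterisation of
`exists_certified_states` (rigid classes), the states at `b` inject into the `3`-subsets of the neighbours of `b`
at distance `1` that are pairwise at distance `1` (an equilateral unit triangle on the kissing sphere of `b`).
This turns the crude `220 = C(12,3)` into a local-geometry quantity (`8` for an fcc or hcp shell) for the exact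
accounting of the constant; the bound on that quantity for general unit-separated neighbourhoods is NOT proved here. -/
theorem card_certified_at_le_unitTriangles
    (hinj : ∀ κ κ' : K, (F κ : EuclideanSpace ℝ (Fin 3) → EuclideanSpace ℝ (Fin 3)) '' ↑fccSlots =
      (F κ' : EuclideanSpace ℝ (Fin 3) → EuclideanSpace ℝ (Fin 3)) '' ↑fccSlots → κ = κ')
    (W : Finset (EuclideanSpace ℝ (Fin 3) × K))
    (hW : ∀ v, v ∈ W ↔ (v.1 ∈ X ∧
        (∃ a ∈ fccSlots, ∃ a' ∈ fccSlots, ∃ a'' ∈ fccSlots,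
          ⟪a, a'⟫_ℝ = 1 / 2 ∧ ⟪a, a''⟫_ℝ = 1 / 2 ∧ ⟪a', a''⟫_ℝ = 1 / 2 ∧
          v.1 + F v.2 a ∈ X ∧ v.1 + F v.2 a' ∈ X ∧ v.1 + F v.2 a'' ∈ X) ∧
        v.1 - d v.2 ∈ X))
    (b : EuclideanSpace ℝ (Fin 3)) :
    (W.filter fun v => v.1 = b).card ≤
      (((X.filter fun q => dist b q = 1).powersetCard 3).filter fun t =>
        ∀ p ∈ t, ∀ q ∈ t, p ≠ q → dist p q = 1).card := by
  set T := ((X.filter fun q => dist b q = 1).powersetCard 3).filter fun t =>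
      ∀ p ∈ t, ∀ q ∈ t, p ≠ q → dist p q = 1 with hT
  set Wb := W.filter fun v => v.1 = b with hWb
  -- the triangle of a state at `b`
  set piece : Finset (EuclideanSpace ℝ (Fin 3)) → Finset (EuclideanSpace ℝ (Fin 3) × K) := fun t =>
    Wb.filter fun v => ∃ a ∈ fccSlots, ∃ a' ∈ fccSlots, ∃ a'' ∈ fccSlots,
      ⟪a, a'⟫_ℝ = 1 / 2 ∧ ⟪a, a''⟫_ℝ = 1 / 2 ∧ ⟪a', a''⟫_ℝ = 1 / 2 ∧
      ({b + F v.2 a, b + F v.2 a', b + F v.2 a''} : Finset (EuclideanSpace ℝ (Fin 3))) = t with hpiece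
  have hcov : Wb ⊆ T.biUnion piece := by
    intro v hv
    obtain ⟨hvW, hvb⟩ := mem_filter.1 hv
    obtain ⟨-, ⟨a, ha, a', ha', a'', ha'', i1, i2, i3, h1, h2, h3⟩, -⟩ := (hW v).1 hvW
    rw [hvb] at h1 h2 h3
    rw [mem_biUnion]
    refine ⟨{b + F v.2 a, b + F v.2 a', b + F v.2 a''}, ?_, mem_filter.2 ⟨hv, a, ha, a', ha', a'', ha'', i1, i2, i3, rfl⟩⟩
    have d12 := dist_frame_slots_eq_one (F v.2) b ha ha' i1
    have d13 := dist_frame_slots_eq_one (F v.2) b ha ha'' i2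
    have d23 := dist_frame_slots_eq_one (F v.2) b ha' ha'' i3
    have n12 : b + F v.2 a ≠ b + F v.2 a' := by
      rw [Ne, add_right_inj]; exact frame_slot_ne_of_inner_half (F v.2) ha i1
    have n13 : b + F v.2 a ≠ b + F v.2 a'' := by
      rw [Ne, add_right_inj]; exact frame_slot_ne_of_inner_half (F v.2) ha i2
    have n23 : b + F v.2 a' ≠ b + F v.2 a'' := by
      rw [Ne, add_right_inj]; exact frame_slot_ne_of_inner_half (F v.2) ha' i3
    have hd : ∀ x ∈ fccSlots, dist b (b + F v.2 x) = 1 := by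
      intro x hx
      rw [dist_eq_norm, sub_add_cancel_left, norm_neg, LinearIsometryEquiv.norm_map, norm_eq_one_of_mem_fccSlots hx]
    rw [hT, mem_filter, mem_powersetCard]
    refine ⟨⟨?_, ?_⟩, ?_⟩
    · intro x hx
      simp only [mem_insert, mem_singleton] at hx
      rw [mem_filter]
      rcases hx with rfl | rfl | rfl
      · exact ⟨h1, hd a ha⟩
      · exact ⟨h2, hd a' ha'⟩
      · exact ⟨h3, hd a'' ha''⟩
    · rw [card_insert_of_notMem, card_insert_of_notMem, card_singleton]
      · simpa using n23
      · simp [n12, n13]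
    · intro p hp q hq hpq
      simp only [mem_insert, mem_singleton] at hp hq
      rcases hp with rfl | rfl | rfl <;> rcases hq with rfl | rfl | rfl
      · exact absurd rfl hpq
      · exact d12
      · exact d13
      · rw [dist_comm]; exact d12
      · exact absurd rfl hpq
      · exact d23
      · rw [dist_comm]; exact d13
      · rw [dist_comm]; exact d23
      · exact absurd rfl hpq
  have hsub1 : ∀ t ∈ T, (piece t).card ≤ 1 := by
    intro t _
    rw [Finset.card_le_one]
    intro v hv v' hv'
    obtain ⟨hvb, a, ha, a', ha', a'', ha'', i1, i2, i3, ht⟩ := mem_filter.1 hv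
    obtain ⟨hvb', c, hc, c', hc', c'', hc'', -, -, -, ht'⟩ := mem_filter.1 hv'
    have hκ : v.2 = v'.2 :=
      class_eq_of_triangle_set_eq hinj ha ha' ha'' i1 i2 i3 hc hc' hc'' (ht.trans ht'.symm)
    exact Prod.ext ((mem_filter.1 hvb).2.trans (mem_filter.1 hvb').2.symm) hκ
  calc Wb.card ≤ (T.biUnion piece).card := card_le_card hcov
    _ ≤ ∑ t ∈ T, (piece t).card := card_biUnion_le
    _ ≤ ∑ _t ∈ T, 1 := sum_le_sum hsub1
    _ = T.card := by rw [sum_const, smul_eq_mul, mul_one]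

end States

end Summit.Ventures.Crystal3D.Theorems

end
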